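import Mathlib
import HarnessLib
import Summits.HubbardSuperconductivity.HubbardSuperconductivity.Theorems.KLProgrammeC4aLoopAlignment

/-!
# Route `KLProgramme` — crux C4a, S3 brick (B2-trans)(b) GEOMETRY, part 3′: the alignment dichotomy on an ARBITRARY SHEET of the partner —
# partner `S − Φ(e,φ+θ) = Φ(e′,ψ) + v` with `v` a period of `e_K` (umklapp sheet `v = 2πG`): small slope ⇒ `‖S − v‖` small (impossible for `G ≠ 0` on the window:
# `‖S‖ ≤ 2u_max < 2π`) OR `‖S − v − 2Φ(0,φ+θ)‖` small = the UMKLAPP CAUSTIC `S ∈ 2·FS + 2πG` of this row's note «LOOP-UMKLAPP»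

Cell `gate-hubbard-kl`, seat hubbard-kl-k3c3-p3 g19; helper for stub (C) `stub_twoLeg_curvature` of `KLRegimeEngineV17F2` (stmt-HubbardSuperconductivity-20437),
lane hubbard-kl-c4a-1's S3 plan §24.2/§24.10 and the umklapp clause flagged in HOME/hubbard-kl-k3c3-p3/B2TRANS-UMKLAPP.md §2(b).  Part 3 (`…C4aLoopAlignment`)
treats the direct sheet `v = 0`; here `v : Momentum` is any vector with `e_K(q + v) = e_K(q)` for all `q` (for the lattice band and a `C₄ᵥ` trigonometric frame:
`v ∈ 2πℤ²`), so that the slope at the loop point is still the slope form at the chart point `Φ(e′,ψ)` and part 2's Gauss law applies verbatim: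
* `fderiv_frameLevel_add_period` — `De_K(q + v) = De_K(q)`; `deriv_partnerBand_pp_angle_eq_neg_sheet` (`∂_φē = −De_K(Φ(e′,ψ))[∂_sΦ(e,φ+θ)]`);
* **`norm_pairSum_sub_period_le_of_cooperBranch`** (`‖S − v‖ ≤ msD·τ + |e−e′|/(Dt−2A)`), **`norm_pairSum_sub_period_sub_two_le_of_tangencyBranch`**
  (`‖S − v − 2Φ(0,φ+θ)‖ ≤ msD·τ + (|e|+|e′|)/(Dt−2A)`), **`loopAlignment_dichotomy_sheet`** (the two assembled with part 3's `τ(ℓ, e, e′)`).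
CONSUMER'S READING: for `v = 2πG ≠ 0` the first branch contradicts `‖S‖ ≤ ‖Φ(0,θ)‖ + ‖Φ(ρ,ϑ+θ)‖ < 2π − margin` once `τ, |e − e′|` are small, so on an umklapp
sheet a small slope with a small partner level happens ONLY near the umklapp caustic `‖S − 2πG − 2Φ(0,φ+θ)‖ ≲ τ + |e| + |e′|` — the (T_G) locus of the note,
where the co-moving derivative is genuinely hard (anisotropy defect `≠ 0`).  Nothing about the model's sizes; nothing asserts superconductivity.
References: BGM 2003 §7.1 Lemma 7.1 (A1.9) [cite: BenfattoGiulianiMastropietro2003]; FST II CPAM 51 (1998) §3, App. B [cite: FeldmanSalmhoferTrubowitz1998].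
-/

noncomputable section

namespace Summit.HubbardSuperconductivity.HubbardSuperconductivity.Theorems.C4a

set_option linter.dupNamespace false -- summit = problem name (single-conjunct summit), D-0017

open Real Set
open Literature.MathematicalPhysics.QuantumLattice Literature.MathematicalPhysics.QuantumLattice.BandSectorCounting
open Literature.MathematicalPhysics.QuantumLattice.FermiRG
open Summit.HubbardSuperconductivity.HubbardSuperconductivity.Theorems.KLRegimeSplit
open Summit.HubbardSuperconductivity.HubbardSuperconductivity.Theorems.DispersionFlow
open Summit.HubbardSuperconductivity.HubbardSuperconductivity.Theorems.PerturbedFermiCurve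

/-- **A period of the band is a period of its derivative**: if `e_K(q + v) = e_K(q)` for all `q` then `De_K(q + v) = De_K(q)`. -/
theorem fderiv_frameLevel_add_period (μ : ℝ) (K : TrigPolyC4v) {v : Momentum} (hv : ∀ q : Momentum, frameLevel μ K (q + v) = frameLevel μ K q)
    (q : Momentum) : fderiv ℝ (frameLevel μ K) (q + v) = fderiv ℝ (frameLevel μ K) q := by
  have hfun : (fun x : Momentum => frameLevel μ K (x + v)) = frameLevel μ K := funext hv
  conv_rhs => rw [← hfun]
  rw [fderiv_comp_add_right]

section Sizes

variable {K : TrigPolyC4v} {A : ℝ} (hA : ∀ p : Momentum, ∀ j ≤ 2, ‖iteratedFDeriv ℝ j (frameShift K) p‖ ≤ A) (hA20 : A ≤ 1 / 20)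
  (hd : klCurveD ≤ (bandBounds (show (-4 : ℝ) < -1.1 by norm_num) (show (-1.1 : ℝ) ≤ -0.1 by norm_num)
    (show (-0.1 : ℝ) < 0 by norm_num)).Dtmin - 2 * A)
  {μ r : ℝ} (hr : 0 < r) (hlo : (-1.1 : ℝ) < μ - r - A) (hhi : μ + r + A < -0.1)
  {A₃ A₄ : ℝ} (hA₃ : ∀ p : Momentum, ‖iteratedFDeriv ℝ 3 (frameShift K) p‖ ≤ A₃)
  (hA₄ : ∀ p : Momentum, ‖iteratedFDeriv ℝ 4 (frameShift K) p‖ ≤ A₄)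
include hA hA20 hd hr hlo hhi hA₃ hA₄

omit hA20 hr hA₃ hA₄ in
/-- **Slope on the sheet `v`**: if `S − Φ(e,φ+θ) = Φ(e′,ψ) + v` with `v` a period of `e_K`, then `∂_φ e_K(S − Φ(e,·+θ))|_φ = −De_K(Φ(e′,ψ))[∂_sΦ(e,φ+θ)]`. -/
theorem deriv_partnerBand_pp_angle_eq_neg_sheet {v : Momentum} (hv : ∀ q : Momentum, frameLevel μ K (q + v) = frameLevel μ K q) {ρ e e' : ℝ}
    (he : |e| < r) {ϑ θ φ ψ : ℝ} (hP : pairSumPath μ K ρ ϑ θ 0 - levelPoint μ K e (φ + θ) = levelPoint μ K e' ψ + v) :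
    deriv (fun x : ℝ => frameLevel μ K (pairSumPath μ K ρ ϑ θ 0 - levelPoint μ K e (x + θ))) φ =
      -fderiv ℝ (frameLevel μ K) (levelPoint μ K e' ψ) (iteratedDeriv 1 (levelPoint μ K e) (φ + θ)) := by
  rw [(hasDerivAt_partnerBand_pp_angle hA hd hlo hhi (ρ := ρ) he ϑ θ φ).deriv, hP, fderiv_frameLevel_add_period μ K hv]

omit hA hA20 hd hr hlo hhi hA₃ hA₄ in
/-- The pair sum on the sheet: `S − v = Φ(e,φ+θ) + Φ(e′,ψ)`. -/
theorem pairSum_sub_period_eq_add_of_partner {v : Momentum} {ρ e e' : ℝ} {ϑ θ φ ψ : ℝ}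
    (hP : pairSumPath μ K ρ ϑ θ 0 - levelPoint μ K e (φ + θ) = levelPoint μ K e' ψ + v) :
    pairSumPath μ K ρ ϑ θ 0 - v = levelPoint μ K e (φ + θ) + levelPoint μ K e' ψ := by
  have h : pairSumPath μ K ρ ϑ θ 0 = levelPoint μ K e' ψ + v + levelPoint μ K e (φ + θ) := by rw [← hP]; abel
  rw [h]; abel

omit hr in
/-- **Cooper branch on the sheet `v`**: `‖ψ − (φ+θ) − π‖_𝕋 ≤ τ ⇒ ‖S − v‖ ≤ msD A₃ A₄ 1·τ + |e − e′|/(Dt−2A)`. -/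
theorem norm_pairSum_sub_period_le_of_cooperBranch {v : Momentum} {ρ e e' : ℝ} (he : |e| < r) (he' : |e'| < r) {ϑ θ φ ψ τ : ℝ}
    (hP : pairSumPath μ K ρ ϑ θ 0 - levelPoint μ K e (φ + θ) = levelPoint μ K e' ψ + v) (hτ : torusDist (ψ - (φ + θ) - π) ≤ τ) :
    ‖pairSumPath μ K ρ ϑ θ 0 - v‖ ≤ msD A₃ A₄ 1 * τ +
      |e - e'| / ((bandBounds (show (-4 : ℝ) < -1.1 by norm_num) (show (-1.1 : ℝ) ≤ -0.1 by norm_num) (show (-0.1 : ℝ) < 0 by norm_num)).Dtmin - 2 * A) := by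
  -- reduce to part 3: the SHIFTED pair sum `S − v` has the direct-sheet partner `Φ(e′,ψ)`; part 3's Cooper lemma only uses `S = Φ(e,φ+θ) + Φ(e′,ψ)`
  set B := bandBounds (show (-4 : ℝ) < -1.1 by norm_num) (show (-1.1 : ℝ) ≤ -0.1 by norm_num) (show (-0.1 : ℝ) < 0 by norm_num) with hBdef
  have hADt : 2 * A < B.Dtmin := by have := klCurveD_pos; linarith
  have heI : e ∈ Ioo (-r) r := ⟨(abs_lt.1 he).1, (abs_lt.1 he).2⟩
  have heI' : e' ∈ Ioo (-r) r := ⟨(abs_lt.1 he').1, (abs_lt.1 he').2⟩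
  rw [pairSum_sub_period_eq_add_of_partner hP]
  have hsplit : levelPoint μ K e (φ + θ) + levelPoint μ K e' ψ =
      (levelPoint μ K e' ψ - levelPoint μ K e' (φ + θ + π)) + (levelPoint μ K e (φ + θ) - levelPoint μ K e' (φ + θ)) := by
    rw [levelPoint_add_pi]; abel
  rw [hsplit]
  have h1 : ‖levelPoint μ K e' ψ - levelPoint μ K e' (φ + θ + π)‖ ≤ msD A₃ A₄ 1 * τ := by
    refine (norm_levelPoint_sub_le_torusDist hA hA20 hd hlo hhi hA₃ hA₄ he' ψ (φ + θ + π)).trans ?_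
    have hD0 : 0 ≤ msD A₃ A₄ 1 := (norm_nonneg _).trans (norm_iteratedDeriv_levelPoint_le hA hA20 hd hlo hhi hA₃ hA₄ he le_rfl (by norm_num) 0)
    rw [show ψ - (φ + θ + π) = ψ - (φ + θ) - π by ring]
    exact mul_le_mul_of_nonneg_left hτ hD0
  have h2 : ‖levelPoint μ K e (φ + θ) - levelPoint μ K e' (φ + θ)‖ ≤ |e - e'| / (B.Dtmin - 2 * A) :=
    norm_levelPoint_sub_levelPoint_le B hA hADt hlo hhi heI heI' (φ + θ)
  exact (norm_add_le _ _).trans (add_le_add h1 h2)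

omit hr in
/-- **Tangency branch on the sheet `v`**: `‖ψ − (φ+θ)‖_𝕋 ≤ τ ⇒ ‖S − v − 2Φ(0,φ+θ)‖ ≤ msD A₃ A₄ 1·τ + (|e| + |e′|)/(Dt−2A)` — the configuration is within that of
the umklapp caustic `S ∈ 2·FS + v`. -/
theorem norm_pairSum_sub_period_sub_two_le_of_tangencyBranch {v : Momentum} {ρ e e' : ℝ} (he : |e| < r) (he' : |e'| < r) {ϑ θ φ ψ τ : ℝ}
    (hP : pairSumPath μ K ρ ϑ θ 0 - levelPoint μ K e (φ + θ) = levelPoint μ K e' ψ + v) (hτ : torusDist (ψ - (φ + θ)) ≤ τ) :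
    ‖pairSumPath μ K ρ ϑ θ 0 - v - (2 : ℝ) • levelPoint μ K 0 (φ + θ)‖ ≤ msD A₃ A₄ 1 * τ +
      (|e| + |e'|) / ((bandBounds (show (-4 : ℝ) < -1.1 by norm_num) (show (-1.1 : ℝ) ≤ -0.1 by norm_num) (show (-0.1 : ℝ) < 0 by norm_num)).Dtmin - 2 * A) := by
  set B := bandBounds (show (-4 : ℝ) < -1.1 by norm_num) (show (-1.1 : ℝ) ≤ -0.1 by norm_num) (show (-0.1 : ℝ) < 0 by norm_num) with hBdef
  have hADt : 2 * A < B.Dtmin := by have := klCurveD_pos; linarith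
  have heI : e ∈ Ioo (-r) r := ⟨(abs_lt.1 he).1, (abs_lt.1 he).2⟩
  have heI' : e' ∈ Ioo (-r) r := ⟨(abs_lt.1 he').1, (abs_lt.1 he').2⟩
  have h0I : (0 : ℝ) ∈ Ioo (-r) r := ⟨by linarith [(abs_lt.1 he).1, (abs_lt.1 he).2], lt_of_le_of_lt (abs_nonneg e) he⟩
  rw [pairSum_sub_period_eq_add_of_partner hP]
  have hsplit : levelPoint μ K e (φ + θ) + levelPoint μ K e' ψ - (2 : ℝ) • levelPoint μ K 0 (φ + θ) =
      (levelPoint μ K e (φ + θ) - levelPoint μ K 0 (φ + θ)) + (levelPoint μ K e' ψ - levelPoint μ K e' (φ + θ)) +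
        (levelPoint μ K e' (φ + θ) - levelPoint μ K 0 (φ + θ)) := by
    rw [two_smul]; abel
  rw [hsplit]
  have h1 : ‖levelPoint μ K e (φ + θ) - levelPoint μ K 0 (φ + θ)‖ ≤ |e| / (B.Dtmin - 2 * A) := by
    simpa using norm_levelPoint_sub_levelPoint_le B hA hADt hlo hhi heI h0I (φ + θ)
  have h2 : ‖levelPoint μ K e' ψ - levelPoint μ K e' (φ + θ)‖ ≤ msD A₃ A₄ 1 * τ := by
    refine (norm_levelPoint_sub_le_torusDist hA hA20 hd hlo hhi hA₃ hA₄ he' ψ (φ + θ)).trans ?_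
    have hD0 : 0 ≤ msD A₃ A₄ 1 := (norm_nonneg _).trans (norm_iteratedDeriv_levelPoint_le hA hA20 hd hlo hhi hA₃ hA₄ he le_rfl (by norm_num) 0)
    exact mul_le_mul_of_nonneg_left hτ hD0
  have h3 : ‖levelPoint μ K e' (φ + θ) - levelPoint μ K 0 (φ + θ)‖ ≤ |e'| / (B.Dtmin - 2 * A) := by
    simpa using norm_levelPoint_sub_levelPoint_le B hA hADt hlo hhi heI' h0I (φ + θ)
  calc _ ≤ ‖levelPoint μ K e (φ + θ) - levelPoint μ K 0 (φ + θ)‖ + ‖levelPoint μ K e' ψ - levelPoint μ K e' (φ + θ)‖ +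
        ‖levelPoint μ K e' (φ + θ) - levelPoint μ K 0 (φ + θ)‖ := norm_add₃_le
    _ ≤ |e| / (B.Dtmin - 2 * A) + msD A₃ A₄ 1 * τ + |e'| / (B.Dtmin - 2 * A) := add_le_add (add_le_add h1 h2) h3
    _ = msD A₃ A₄ 1 * τ + (|e| + |e'|) / (B.Dtmin - 2 * A) := by rw [add_div]; ring

omit hr in
/-- **THE ALIGNMENT DICHOTOMY ON THE SHEET `v`** (umklapp sheets `v = 2πG`).  Under `GeomConstants (frameLevel μ K) Kc r₀ g₀ w`, for the co-moving pp loop point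
`Φ(e,φ+θ)` (`|e| < r`, `|e| < r₀`) whose partner is `Φ(e′,ψ) + v` (`|e′| < r`, `v` a period of `e_K`), with `ℓ = De_K(Φ(e′,ψ))[∂_sΦ(e,φ+θ)] = −∂_φē` and
`τ = ((π/2)|ℓ|/((Dt−2A)u_min) + πKc|e′−e|/(Dt−2A)²)/c_K`: EITHER `‖S − v‖ ≤ msD·τ + |e − e′|/(Dt−2A)` OR `‖S − v − 2Φ(0,φ+θ)‖ ≤ msD·τ + (|e|+|e′|)/(Dt−2A)`.
[cite: BenfattoGiulianiMastropietro2003, §7.1 Lemma 7.1 (A1.9)] -/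
theorem loopAlignment_dichotomy_sheet {Kc r₀ g₀ w : ℝ} (hG : GeomConstants (frameLevel μ K) Kc r₀ g₀ w) {v : Momentum}
    {e e' : ℝ} (he : |e| < r) (he' : |e'| < r) (he₀ : |e| < r₀) {ρ ϑ θ φ ψ : ℝ}
    (hP : pairSumPath μ K ρ ϑ θ 0 - levelPoint μ K e (φ + θ) = levelPoint μ K e' ψ + v) :
    ‖pairSumPath μ K ρ ϑ θ 0 - v‖ ≤
        msD A₃ A₄ 1 *
            ((π / 2 * |fderiv ℝ (frameLevel μ K) (levelPoint μ K e' ψ) (iteratedDeriv 1 (levelPoint μ K e) (φ + θ))| /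
                  (((bandBounds (show (-4 : ℝ) < -1.1 by norm_num) (show (-1.1 : ℝ) ≤ -0.1 by norm_num) (show (-0.1 : ℝ) < 0 by norm_num)).Dtmin -
                      2 * A) *
                    (bandBounds (show (-4 : ℝ) < -1.1 by norm_num) (show (-1.1 : ℝ) ≤ -0.1 by norm_num) (show (-0.1 : ℝ) < 0 by norm_num)).umin) +
                π * Kc * |e' - e| / ((bandBounds (show (-4 : ℝ) < -1.1 by norm_num) (show (-1.1 : ℝ) ≤ -0.1 by norm_num)
                  (show (-0.1 : ℝ) < 0 by norm_num)).Dtmin - 2 * A) ^ 2) /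
              ((bandBounds (show (-4 : ℝ) < -1.1 by norm_num) (show (-1.1 : ℝ) ≤ -0.1 by norm_num) (show (-0.1 : ℝ) < 0 by norm_num)).umin * w /
                (4 + 2 * A))) +
          |e - e'| / ((bandBounds (show (-4 : ℝ) < -1.1 by norm_num) (show (-1.1 : ℝ) ≤ -0.1 by norm_num) (show (-0.1 : ℝ) < 0 by norm_num)).Dtmin - 2 * A) ∨
      ‖pairSumPath μ K ρ ϑ θ 0 - v - (2 : ℝ) • levelPoint μ K 0 (φ + θ)‖ ≤
        msD A₃ A₄ 1 *
            ((π / 2 * |fderiv ℝ (frameLevel μ K) (levelPoint μ K e' ψ) (iteratedDeriv 1 (levelPoint μ K e) (φ + θ))| /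
                  (((bandBounds (show (-4 : ℝ) < -1.1 by norm_num) (show (-1.1 : ℝ) ≤ -0.1 by norm_num) (show (-0.1 : ℝ) < 0 by norm_num)).Dtmin -
                      2 * A) *
                    (bandBounds (show (-4 : ℝ) < -1.1 by norm_num) (show (-1.1 : ℝ) ≤ -0.1 by norm_num) (show (-0.1 : ℝ) < 0 by norm_num)).umin) +
                π * Kc * |e' - e| / ((bandBounds (show (-4 : ℝ) < -1.1 by norm_num) (show (-1.1 : ℝ) ≤ -0.1 by norm_num)
                  (show (-0.1 : ℝ) < 0 by norm_num)).Dtmin - 2 * A) ^ 2) /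
              ((bandBounds (show (-4 : ℝ) < -1.1 by norm_num) (show (-1.1 : ℝ) ≤ -0.1 by norm_num) (show (-0.1 : ℝ) < 0 by norm_num)).umin * w /
                (4 + 2 * A))) +
          (|e| + |e'|) / ((bandBounds (show (-4 : ℝ) < -1.1 by norm_num) (show (-1.1 : ℝ) ≤ -0.1 by norm_num) (show (-0.1 : ℝ) < 0 by norm_num)).Dtmin - 2 * A) := by
  set B := bandBounds (show (-4 : ℝ) < -1.1 by norm_num) (show (-1.1 : ℝ) ≤ -0.1 by norm_num) (show (-0.1 : ℝ) < 0 by norm_num) with hBdef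
  have hA0 : 0 ≤ A := (norm_nonneg _).trans (hA 0 0 (by norm_num))
  have hcK : 0 < B.umin * w / (4 + 2 * A) := by have := B.umin_pos; have := hG.wmin_pos; positivity
  set τ := (π / 2 * |fderiv ℝ (frameLevel μ K) (levelPoint μ K e' ψ) (iteratedDeriv 1 (levelPoint μ K e) (φ + θ))| /
        ((B.Dtmin - 2 * A) * B.umin) + π * Kc * |e' - e| / (B.Dtmin - 2 * A) ^ 2) / (B.umin * w / (4 + 2 * A)) with hτdef
  have hal := loopAlignment_angle_le hA hd hlo hhi hG he he' he₀ φ θ ψ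
  have hmin : min (torusDist (ψ - (φ + θ))) (torusDist (ψ - (φ + θ) - π)) ≤ τ := by
    rw [hτdef, le_div_iff₀ hcK, mul_comm]; exact hal
  rcases min_le_iff.1 hmin with h | h
  · exact Or.inr (norm_pairSum_sub_period_sub_two_le_of_tangencyBranch hA hA20 hd hlo hhi hA₃ hA₄ he he' hP h)
  · exact Or.inl (norm_pairSum_sub_period_le_of_cooperBranch hA hA20 hd hlo hhi hA₃ hA₄ he he' hP h)

end Sizes

end Summit.HubbardSuperconductivity.HubbardSuperconductivity.Theorems.C4a

end
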